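import Summits.HubbardSuperconductivity.HubbardSuperconductivity.Theorems.AnisotropyChordInsertionEntropyUniformDensity
import Summits.HubbardSuperconductivity.HubbardSuperconductivity.Theorems.AnisotropyChordInsertionEntropyResidue

/-!
# Route `AnisotropyChord` / H0 rotor rung: the entropy-route LINKS with the support statements discharged —
# crux E (resp. E_Z) + sector bookkeeping ⇒ eventual condensation (theory seat memo ROTOR-THEORY-7 §84, §97)

With `uniformSiteDensity_holds` and `perronSectorExists_of_ne_bot` (`…InsertionEntropyUniformDensity`) the
hypotheses `UniformSiteDensity` and `PerronSectorExists` of the theory seat's links are theorems, so: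

* `eventualCondensate_of_insertionEntropyBound'` — **E ⇒ EventualCondensate** along any sector sequence
  `M L` with density `1/2 + M L/L² → ρ ∈ (0,1)` whose reference sectors `M L − 1` are eventually
  non-trivial;
* `eventualCondensate_of_residueBound'` — **E_Z ⇒ EventualCondensate** likewise (reference density
  eventually `≤ ρ' < 1`).

Nothing here claims E or E_Z.  No definition is introduced.
-/

set_option linter.dupNamespace false

noncomputable section

namespace Summit.HubbardSuperconductivity.HubbardSuperconductivity.Theorems.AnisotropyChord.InsertionEntropy

open Filter Topology
open Literature.MathematicalPhysics.QuantumLattice Literature.Probability.LatticeModels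

/-- **Crux E ⇒ eventual condensation, support statements discharged:** along a sector sequence with
density `→ ρ ∈ (0,1)` and eventually non-trivial reference sectors, `InsertionEntropyBound Δ M` gives a
uniform positive floor on the condensate density of every Perron sector ground amplitude, eventually in `L`.
Theory seat memo ROTOR-THEORY-7 §84 with `uniformSiteDensity_holds`, `perronSectorExists_of_ne_bot`. [folklore] -/
theorem eventualCondensate_of_insertionEntropyBound' (Δ : ℝ) (M : ℕ → ℝ) (ρ : ℝ)
    (hρ : ρ ∈ Set.Ioo (0 : ℝ) 1)
    (hlim : Tendsto (fun L : ℕ => 1 / 2 + M L / (L : ℝ) ^ 2) atTop (𝓝 ρ))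
    (hsect : ∀ᶠ L : ℕ in atTop, ∀ [NeZero L], spinZSector (Λ := TorusSite 2 L) 1 (M L - 1) ≠ ⊥)
    (hE : InsertionEntropyBound Δ M) :
    EventualCondensate Δ M :=
  eventualCondensate_of_insertionEntropyBound Δ M ρ hρ hlim hE (uniformSiteDensity_holds Δ M)
    (perronSectorExists_of_ne_bot Δ M hsect)

/-- **Crux E_Z ⇒ eventual condensation, support statements discharged** (weakest head of the route):
theory seat memo ROTOR-THEORY-7 §97 with `uniformSiteDensity_holds` (both sectors) and
`perronSectorExists_of_ne_bot`. [folklore] -/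
theorem eventualCondensate_of_residueBound' (Δ : ℝ) (M : ℕ → ℝ) (ρ ρ' : ℝ)
    (hρ : ρ ∈ Set.Ioo (0 : ℝ) 1) (hρ' : ρ' < 1)
    (hlim : Tendsto (fun L : ℕ => 1 / 2 + M L / (L : ℝ) ^ 2) atTop (𝓝 ρ))
    (hle : ∀ᶠ L : ℕ in atTop, 1 / 2 + (M L - 1) / (L : ℝ) ^ 2 ≤ ρ')
    (hsect : ∀ᶠ L : ℕ in atTop, ∀ [NeZero L], spinZSector (Λ := TorusSite 2 L) 1 (M L - 1) ≠ ⊥)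
    (hZ : InsertionResidueBound Δ M) :
    EventualCondensate Δ M :=
  eventualCondensate_of_residueBound Δ M ρ ρ' hρ hρ' hlim hle hZ (uniformSiteDensity_holds Δ M)
    (uniformSiteDensity_holds Δ (fun L => M L - 1)) (perronSectorExists_of_ne_bot Δ M hsect)

/-- **Crux E ⇒ crux E_Z, support statements discharged** (`z = e^{−K}`): theory seat memo ROTOR-THEORY-7
§97 with `uniformSiteDensity_holds`. [folklore] -/
theorem residueBound_of_insertionEntropyBound' (Δ : ℝ) (M : ℕ → ℝ) (ρ' : ℝ) (hρ' : ρ' < 1)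
    (hpos : ∀ᶠ L : ℕ in atTop, 0 < 1 / 2 + M L / (L : ℝ) ^ 2)
    (hle : ∀ᶠ L : ℕ in atTop, 1 / 2 + (M L - 1) / (L : ℝ) ^ 2 ≤ ρ')
    (hE : InsertionEntropyBound Δ M) : InsertionResidueBound Δ M :=
  residueBound_of_insertionEntropyBound Δ M ρ' hρ' hE (uniformSiteDensity_holds Δ M)
    (uniformSiteDensity_holds Δ (fun L => M L - 1)) hpos hle

/-- **Crux E_J ⇒ crux E, support statements discharged:** theory seat memo ROTOR-THEORY-7 §91 with
`uniformSiteDensity_holds`. [folklore] -/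
theorem insertionEntropyBound_of_jBound' (Δ : ℝ) (M : ℕ → ℝ) (ρ' : ℝ) (hρ' : ρ' < 1)
    (hpos : ∀ᶠ L : ℕ in atTop, 0 < 1 / 2 + M L / (L : ℝ) ^ 2)
    (hle : ∀ᶠ L : ℕ in atTop, 1 / 2 + (M L - 1) / (L : ℝ) ^ 2 ≤ ρ')
    (hJ : InsertionJBound Δ M) : InsertionEntropyBound Δ M :=
  insertionEntropyBound_of_jBound Δ M ρ' hρ' hJ (uniformSiteDensity_holds Δ M)
    (uniformSiteDensity_holds Δ (fun L => M L - 1)) hpos hle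

end Summit.HubbardSuperconductivity.HubbardSuperconductivity.Theorems.AnisotropyChord.InsertionEntropy
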